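import Summits.MatrixMultiplication.OmegaCensus.STPPOrderThreeLemmas

/-!
# ω-census (abelian STPP census): filter N20 — the ORDER-THREE CLASH (Kneser structure ⇒ TPP contradiction, `9 ∤ |H|`; kernel)

HONEST FRAMING (pub-omega census; verbatim): lottery ticket; floor = certified bounds/negative ranges.
Census BOOKKEEPING / STRUCTURE (seat pub-omega-stpp-1 gen 27, 2026-08-27), family (b2).  The `p = 3` twin of N19 (`STPPAlignedInvolutionClash.lean`):
for finite abelian `H` with `9 ∤ |H|` there is at most one subgroup of order `3` (`mem_span_of_three_torsion`: two independent elements of order `3` span a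
subgroup `{i•x + j•y}` of order `9`; Lagrange — `STPPOrderThreeLemmas.lean`).  Setting of N18: block `i`, `K = Stab(Bᵢ + V)`, `K′ = Stab((−Aᵢ) + Y°)`.

**N20 (order-three clash).**  `9 ∤ n` and, at block `i` (another block present): (1) every rescuing pair `(d, d′)` of divisors is `(3, 3)`; (2) for every `t ≤ n` with
`kLB(bᵢ, t, 3) ≤ n − |Z°|`: `t + 3 < 3aᵢ + vol + |Y°|`; (3) `n + 3 < 3bᵢ + |Z°| + vol + kLB(aᵢ, |Y°|, 3)` ⇒ no STPP family.  PROOF.  `|K| = |K′| = 3`,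
`K = {0, κ, 2κ}`, `K′ = {0, κ′, 2κ′}` with `κ′ ∈ {κ, 2κ}` (uniqueness); Kneser's structure inequalities with (2)/(3) give `|−Aᵢ + K′| < 3aᵢ` and `|Bᵢ + K| < 3bᵢ`,
so some coset holds two points: `a₁ − a₂ = g`, `b₂ − b₁ = g′` with `g, g′ ∈ {κ, 2κ} = {κ, −κ}`; hence `g′ = ±g` and one of the words `(a₁ − a₂) + (b₁ − b₂)`,
`(a₁ − a₂) + (b₂ − b₁)` (plus `c − c`) vanishes — the TPP of block `i` then forces `g = 0`.  Predicate `N20Dead` (six role readings, `¬ 9 ∣ n` inside),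
`not_isSTPP_of_n20Dead{1,,'}`.

SCOPE.  `9 ∤ n`: ℤ₅₇ (closed already), BOTH abelian groups of order 60 (ℤ₆₀, ℤ₂×ℤ₃₀), 66, 69, 75, 78, … .  Measured (python twin `code/n19_probe3.py`, d = 3
branch): on the ℤ₅₇ N18-residual 18 the clash kills 5 (list in HOME `fronts/`); no order-60 front exists yet — this file is laid in for it.
SOUNDNESS of the arithmetic: the predicate is N19's with `2 ↦ 3`; python twin vs 568 FEASIBLE / 1 984 SAT records: 0 flagged (HOME `code/n20_filter.py`).

References: M. Kneser, Math. Z. 58 (1953); H. Cohn, R. Kleinberg, B. Szegedy, C. Umans, FOCS 2005 (arXiv:math/0511460), Def. 5.1.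
-/

open Finset
open scoped Pointwise

namespace Summit.MatrixMultiplication.OmegaCensus.CubeNB

open Literature.Computability.AlgebraicComplexity
open Summit.MatrixMultiplication.OmegaCensus.STPPKneser

variable {H : Type*} [AddCommGroup H] [DecidableEq H] [Fintype H] {N : ℕ} {A B C : Fin N → Finset H}

/-! ## §1 The order-three clash -/

section Law

/-- **N20 (order-three clash), `C`-reading.**  See the module docstring. [cite: Kneser1953] [cite: CohnKleinbergSzegedyUmans2005, Def. 5.1] -/
theorem order_three_clash (hS : IsSTPP A B C) (hA : ∀ i, (A i).Nonempty) (hB : ∀ i, (B i).Nonempty)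
    (hC : ∀ i, (C i).Nonempty) (h9 : ¬ 9 ∣ Fintype.card H) (i : Fin N) (hI : (univ.erase i : Finset (Fin N)).Nonempty)
    (h1 : ∀ d d' : ℕ, 0 < d → d ∣ Fintype.card H → 0 < d' → d' ∣ Fintype.card H →
      ∑ k ∈ univ.erase i, #(A k) * #(C k) +
        kneserLB #(B i) (#(A i) * #(B i) * #(C i) + kneserLB #(A i) (∑ k ∈ univ.erase i, #(B k) * #(C k)) d') d ≤
          Fintype.card H → d = 3 ∧ d' = 3)
    (h2 : ∀ t : ℕ, t ≤ Fintype.card H → kneserLB #(B i) t 3 + ∑ k ∈ univ.erase i, #(A k) * #(C k) ≤ Fintype.card H →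
      t + 3 < 3 * #(A i) + #(A i) * #(B i) * #(C i) + ∑ k ∈ univ.erase i, #(B k) * #(C k))
    (h3 : Fintype.card H + 3 < 3 * #(B i) + ∑ k ∈ univ.erase i, #(A k) * #(C k) + #(A i) * #(B i) * #(C i) +
      kneserLB #(A i) (∑ k ∈ univ.erase i, #(B k) * #(C k)) 3) : False := by
  -- the sets
  set W := ((A i) ×ˢ ((B i) ×ˢ (C i))).image fun q : H × H × H => (0 : H) + q.2.2 - q.1 - q.2.1 with hW
  set S := (A i).image (fun a => (0 : H) - a) with hSdef
  set Yo := DU B C (univ.erase i) with hYo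
  set Zo := DU A C (univ.erase i) with hZo
  set V := W ∪ (S + Yo) with hV
  have hWcard : #W = #(A i) * #(B i) * #(C i) := card_image_blockSum hS i 0
  have hScard : #S = #(A i) := Finset.card_image_of_injective _ (sub_right_injective)
  have hYcard : #Yo = ∑ k ∈ univ.erase i, #(B k) * #(C k) := card_DU_BC hS hA _
  have hZcard : #Zo = ∑ k ∈ univ.erase i, #(A k) * #(C k) := card_DU_AC hS hB _
  have hSne : S.Nonempty := (hA i).image _
  have hYne : Yo.Nonempty := DU_nonempty hI hB hC
  have hSYne : (S + Yo).Nonempty := hSne.add hYne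
  have hWV : Disjoint W (S + Yo) := disjoint_W_negA_add_DU hS i
  have hVcard : #V = #W + #(S + Yo) := Finset.card_union_of_disjoint hWV
  have hVne : V.Nonempty := hSYne.mono Finset.subset_union_right
  have hBVne : (B i + V).Nonempty := (hB i).add hVne
  -- the inclusion Bᵢ + V ⊆ H ∖ Z°
  have hU : #(univ \ Zo) = Fintype.card H - #Zo := by
    rw [Finset.card_sdiff_of_subset (Finset.subset_univ _), Finset.card_univ]
  have hZle : #Zo ≤ Fintype.card H := Finset.card_le_univ _
  have hsub0 := Finset.card_le_card (B_add_W_union_negA_add_subset hS i)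
  rw [hU] at hsub0
  have hsub : #(B i + V) ≤ Fintype.card H - #Zo := hsub0
  -- the two stabilizers
  set K := (B i + V).addStab with hK
  set K' := (S + Yo).addStab with hK'
  have hKne : K.Nonempty := hBVne.addStab
  have hK'ne : K'.Nonempty := hSYne.addStab
  have hKdvd : #K ∣ Fintype.card H := hBVne.card_addStab_dvd_card_univ
  have hK'dvd : #K' ∣ Fintype.card H := hSYne.card_addStab_dvd_card_univ
  -- Kneser with the true stabilizers
  have hkK' : kneserLB #S #Yo #K' ≤ #(S + Yo) := kneserLB_card_addStab_le S Yo hSne hYne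
  have hkK : kneserLB #(B i) #V #K ≤ #(B i + V) := kneserLB_card_addStab_le (B i) V (hB i) hVne
  have hVge : #(A i) * #(B i) * #(C i) + kneserLB #(A i) (∑ k ∈ univ.erase i, #(B k) * #(C k)) #K' ≤ #V := by
    rw [hVcard, hWcard, ← hScard, ← hYcard]; omega
  have hmono := kneserLB_mono_right #(B i) #K hVge
  -- (|K|, |K'|) is a rescuing pair, hence (3, 3)
  obtain ⟨hK2, hK'2⟩ := h1 #K #K' hKne.card_pos hKdvd hK'ne.card_pos hK'dvd (by rw [← hZcard]; omega)
  -- structural Kneser inequalities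
  have hknS := Literature.Combinatorics.Additive.add_kneser S Yo
  have hknB := Literature.Combinatorics.Additive.add_kneser (B i) V
  rw [← hK'] at hknS
  rw [← hK] at hknB
  have hYoK' : #Yo ≤ #(Yo + K') := card_le_card_add_right hK'ne
  have hVK : #V ≤ #(V + K) := card_le_card_add_right hKne
  -- A-side: |S + K'| < 3 |S|
  have hkK2 : kneserLB #(B i) #V 3 ≤ #(B i + V) := by rw [← hK2]; exact hkK
  have h2' := h2 #V (Finset.card_le_univ _) (by rw [← hZcard]; omega)
  have hSlt : #(S + K') < 3 * #S := by
    rw [hK'2] at hknS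
    rw [hScard]; rw [hVcard, hWcard, ← hYcard] at h2'
    omega
  -- B-side: |Bᵢ + K| < 3 |Bᵢ|
  have hkK'2 : kneserLB #(A i) (∑ k ∈ univ.erase i, #(B k) * #(C k)) 3 ≤ #(S + Yo) := by
    rw [← hK'2, ← hScard, ← hYcard]; exact hkK'
  have hBlt : #(B i + K) < 3 * #(B i) := by
    rw [hK2] at hknB
    rw [hVcard, hWcard] at hVK
    rw [← hZcard] at h3
    omega
  -- the order-3 elements of K and K' span the same subgroup
  obtain ⟨κ, hκ0, h3κ, hκK, h2κK⟩ := exists_order_three_of_card_addStab_eq_three hBVne (hK ▸ hK2)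
  obtain ⟨κ', hκ'0, h3κ', hκ'K, h2κ'K⟩ := exists_order_three_of_card_addStab_eq_three hSYne (hK' ▸ hK'2)
  rw [← hK] at hκK h2κK
  rw [← hK'] at hκ'K h2κ'K
  have h0K : (0 : H) ∈ K := hK ▸ Finset.zero_mem_addStab.2 hBVne
  have h0K' : (0 : H) ∈ K' := hK' ▸ Finset.zero_mem_addStab.2 hSYne
  -- two points of Aᵢ in one K'-coset, two points of Bᵢ in one K-coset
  obtain ⟨x, hx, g, hg, hxg⟩ := exists_pair_of_card_add_lt_three h0K' hκ'K h2κ'K hSlt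
  obtain ⟨b₁, hb₁, g', hg', hb₂⟩ := exists_pair_of_card_add_lt_three h0K hκK h2κK hBlt
  obtain ⟨a₁, ha₁, rfl⟩ := Finset.mem_image.1 hx
  obtain ⟨a₂, ha₂, ha₂e⟩ := Finset.mem_image.1 hxg
  obtain ⟨c₀, hc₀⟩ := hC i
  have hk : a₁ - a₂ = g := by
    have h' : -a₂ = -a₁ + g := by simpa only [zero_sub] using ha₂e
    rw [sub_eq_add_neg, h']; abel
  -- g, g' ∈ {κ, κ+κ} with κ + κ = −κ (κ' = κ or κ + κ by uniqueness of the order-3 subgroup), so g' = g or g' = −g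
  have hκκ : κ + κ = -κ := by
    rw [eq_neg_iff_add_eq_zero]; exact h3κ
  have hneg2 : -(κ + κ) = κ := by rw [hκκ, neg_neg]
  have h4κ : κ + κ + (κ + κ) = κ := by rw [hκκ, ← neg_add, hκκ, neg_neg]
  have hκ'mem : κ' = κ ∨ κ' = κ + κ := by
    have h3 : (3 : ℕ) • κ = 0 := by rw [succ_nsmul, two_nsmul]; exact h3κ
    have h3' : (3 : ℕ) • κ' = 0 := by rw [succ_nsmul, two_nsmul]; exact h3κ'
    rcases mem_span_of_three_torsion h9 hκ0 h3 h3' with h | h | h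
    · exact absurd h hκ'0
    · exact Or.inl h
    · exact Or.inr (by rw [h, two_nsmul])
  have hgset : g = κ ∨ g = κ + κ := by
    rcases hκ'mem with rfl | rfl
    · exact hg
    · rcases hg with rfl | rfl
      · exact Or.inr rfl
      · exact Or.inl h4κ
  have hg0 : g ≠ 0 := by
    rcases hgset with rfl | rfl
    · exact hκ0
    · rw [hκκ]; exact neg_ne_zero.2 hκ0
  have hgg : g' = g ∨ g' = -g := by
    rcases hgset with rfl | rfl <;> rcases hg' with rfl | rfl
    · exact Or.inl rfl
    · exact Or.inr hκκ
    · exact Or.inr hneg2.symm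
    · exact Or.inl rfl
  rcases hgg with hgg | hgg
  · -- word (a₁ − a₂) + (b₁ − (b₁ + g')) = g − g' = 0
    have hrel : (a₁ - a₂) + (b₁ - (b₁ + g')) + (c₀ - c₀) = 0 := by rw [hk, hgg]; abel
    obtain ⟨-, -, h12, -, -⟩ := hS i i i a₂ ha₂ a₁ ha₁ (b₁ + g') hb₂ b₁ hb₁ c₀ hc₀ c₀ hc₀ hrel
    exact hg0 (by rw [← hk, h12, sub_self])
  · -- word (a₁ − a₂) + ((b₁ + g') − b₁) = g + g' = 0
    have hrel : (a₁ - a₂) + ((b₁ + g') - b₁) + (c₀ - c₀) = 0 := by rw [hk, hgg]; abel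
    obtain ⟨-, -, h12, -, -⟩ := hS i i i a₂ ha₂ a₁ ha₁ b₁ hb₁ (b₁ + g') hb₂ c₀ hc₀ c₀ hc₀ hrel
    exact hg0 (by rw [← hk, h12, sub_self])

end Law

/-! ## §2 The decidable card-vector predicate (six readings) and the filter theorem -/

section Filter

/-- **Filter N20, one reading** on the card vectors (`C`-reading; `9 ∤ n` inside): conditions (1)–(3) of the module docstring at some block `i` (another block
present).  Same verdicts as HOME `pub-omega-stpp-1-g27/code/n20_filter.py` (`dead_C`). [folklore] -/
def N20Dead1 (n N : ℕ) (a b c : Fin N → ℕ) : Bool :=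
  decide (¬ 9 ∣ n ∧ ∃ i j : Fin N, j ≠ i ∧
    (∀ d ∈ Nat.divisors n, ∀ d' ∈ Nat.divisors n,
      n < ∑ k ∈ univ.erase i, a k * c k + kneserLB (b i) (a i * b i * c i + kneserLB (a i) (∑ k ∈ univ.erase i, b k * c k) d') d
        ∨ (d = 3 ∧ d' = 3)) ∧
    (∀ t : ℕ, t < n + 1 → kneserLB (b i) t 3 + ∑ k ∈ univ.erase i, a k * c k ≤ n →
      t + 3 < 3 * a i + a i * b i * c i + ∑ k ∈ univ.erase i, b k * c k) ∧
    (n + 3 < 3 * b i + ∑ k ∈ univ.erase i, a k * c k + a i * b i * c i + kneserLB (a i) (∑ k ∈ univ.erase i, b k * c k) 3))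

/-- **Filter N20** on the card vectors: `N20Dead1` for one of the six role permutations. [folklore] -/
def N20Dead (n N : ℕ) (a b c : Fin N → ℕ) : Bool :=
  N20Dead1 n N a b c || N20Dead1 n N b c a || N20Dead1 n N c a b ||
    N20Dead1 n N c b a || N20Dead1 n N b a c || N20Dead1 n N a c b

/-- **Filter N20, one reading (kernel).** [cite: Kneser1953] [cite: CohnKleinbergSzegedyUmans2005, Def. 5.1] -/
theorem not_isSTPP_of_n20Dead1 (hS : IsSTPP A B C) (hA : ∀ i, (A i).Nonempty) (hB : ∀ i, (B i).Nonempty)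
    (hC : ∀ i, (C i).Nonempty) {n : ℕ} (hn : Fintype.card H = n) {a b c : Fin N → ℕ} (ha : ∀ i, #(A i) = a i)
    (hb : ∀ i, #(B i) = b i) (hc : ∀ i, #(C i) = c i) (hdead : N20Dead1 n N a b c = true) : False := by
  obtain ⟨h9, i, j, hji, h1, h2, h3⟩ := of_decide_eq_true hdead
  have hI : (univ.erase i : Finset (Fin N)).Nonempty := ⟨j, Finset.mem_erase.2 ⟨hji, Finset.mem_univ _⟩⟩
  have hn0 : n ≠ 0 := by rw [← hn]; exact Fintype.card_ne_zero
  have eAC : ∑ k ∈ univ.erase i, #(A k) * #(C k) = ∑ k ∈ univ.erase i, a k * c k :=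
    Finset.sum_congr rfl fun k _ => by rw [ha, hc]
  have eBC : ∑ k ∈ univ.erase i, #(B k) * #(C k) = ∑ k ∈ univ.erase i, b k * c k :=
    Finset.sum_congr rfl fun k _ => by rw [hb, hc]
  refine order_three_clash hS hA hB hC (hn ▸ h9) i hI ?_ ?_ ?_
  · intro d d' hd hdvd hd' hdvd' hle
    rw [hn] at hdvd hdvd' hle
    rw [ha, hb, hc, eAC, eBC] at hle
    rcases h1 d (Nat.mem_divisors.2 ⟨hdvd, hn0⟩) d' (Nat.mem_divisors.2 ⟨hdvd', hn0⟩) with h | h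
    · omega
    · exact h
  · intro t htle ht
    rw [hn] at htle
    rw [hn, hb, eAC] at ht
    have := h2 t (by omega) ht
    rw [ha, hb, hc, eBC]
    exact this
  · rw [hn, ha, hb, hc, eAC, eBC]
    exact h3

/-- **Filter N20 (kernel): an STPP family with non-empty sets in a finite abelian group `H` with `9 ∤ |H|` whose pattern is `N20Dead |H|` does not exist** —
six readings via `stpp_rotate` and `isSTPP_neg_reverse`. [cite: Kneser1953] [cite: CohnKleinbergSzegedyUmans2005, Def. 5.1] -/
theorem not_isSTPP_of_n20Dead (hS : IsSTPP A B C) (hA : ∀ i, (A i).Nonempty) (hB : ∀ i, (B i).Nonempty)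
    (hC : ∀ i, (C i).Nonempty) {n : ℕ} (hn : Fintype.card H = n) {a b c : Fin N → ℕ} (ha : ∀ i, #(A i) = a i)
    (hb : ∀ i, #(B i) = b i) (hc : ∀ i, #(C i) = c i) (hdead : N20Dead n N a b c = true) : False := by
  simp only [N20Dead, Bool.or_eq_true] at hdead
  have hR := isSTPP_neg_reverse hS
  have hnA : ∀ i, #((fun j => -(A j)) i) = a i := fun i => by rw [card_neg_family, ha]
  have hnB : ∀ i, #((fun j => -(B j)) i) = b i := fun i => by rw [card_neg_family, hb]
  have hnC : ∀ i, #((fun j => -(C j)) i) = c i := fun i => by rw [card_neg_family, hc]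
  rcases hdead with ((((h | h) | h) | h) | h) | h
  · exact not_isSTPP_of_n20Dead1 hS hA hB hC hn ha hb hc h
  · exact not_isSTPP_of_n20Dead1 (stpp_rotate hS) hB hC hA hn hb hc ha h
  · exact not_isSTPP_of_n20Dead1 (stpp_rotate (stpp_rotate hS)) hC hA hB hn hc ha hb h
  · exact not_isSTPP_of_n20Dead1 hR (nonempty_neg_family hC) (nonempty_neg_family hB) (nonempty_neg_family hA)
      hn hnC hnB hnA h
  · exact not_isSTPP_of_n20Dead1 (stpp_rotate hR) (nonempty_neg_family hB) (nonempty_neg_family hA)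
      (nonempty_neg_family hC) hn hnB hnA hnC h
  · exact not_isSTPP_of_n20Dead1 (stpp_rotate (stpp_rotate hR)) (nonempty_neg_family hA) (nonempty_neg_family hC)
      (nonempty_neg_family hB) hn hnA hnC hnB h

/-- Card-vector form with literal vectors: non-emptiness from positivity of the entries. [cite: Kneser1953] [cite: CohnKleinbergSzegedyUmans2005, Def. 5.1] -/
theorem not_isSTPP_of_n20Dead' (hS : IsSTPP A B C) {n : ℕ} (hn : Fintype.card H = n) (a b c : Fin N → ℕ)
    (ha : ∀ i, #(A i) = a i) (hb : ∀ i, #(B i) = b i) (hc : ∀ i, #(C i) = c i)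
    (hpos : ∀ i, 0 < a i ∧ 0 < b i ∧ 0 < c i) (hdead : N20Dead n N a b c = true) : False :=
  not_isSTPP_of_n20Dead hS (fun i => card_pos.1 ((ha i).symm ▸ (hpos i).1))
    (fun i => card_pos.1 ((hb i).symm ▸ (hpos i).2.1)) (fun i => card_pos.1 ((hc i).symm ▸ (hpos i).2.2))
    hn ha hb hc hdead

end Filter

/-! ## §3 Example -/

section Examples

/-- The ℤ₅₇ front leaf `{(2,2,6), (2,3,3), (2,3,3)}` (`Σ abc = 60 > 57`), alive under every filter N7–N12 and N16–N19 (N16 TIGHT at a `(2,3,3)` block: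
`18 + 24 + 15 = 57`; N17/N18 rescued exactly by the stabilizer pair `(3,3)`), carries no STPP family in any abelian group of order `57`: the rescue puts two
points of `A₁` and two points of `B₁` in cosets of the unique order-3 subgroup, against the TPP of block `1`.  (ℤ₅₇ was closed by the census with this leaf
as an engine core; here it becomes a theorem.) [cite: Kneser1953] [cite: CohnKleinbergSzegedyUmans2005, Def. 5.1] -/
theorem no_isSTPP_Z57_226_233_233 (hH : Fintype.card H = 57) (A B C : Fin 3 → Finset H) (hS : IsSTPP A B C)
    (hA : ∀ i, #(A i) = ![2, 2, 2] i) (hB : ∀ i, #(B i) = ![2, 3, 3] i) (hC : ∀ i, #(C i) = ![6, 3, 3] i) : False :=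
  not_isSTPP_of_n20Dead' hS hH _ _ _ hA hB hC (by decide) (by decide)

end Examples

end Summit.MatrixMultiplication.OmegaCensus.CubeNB
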